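import Summits.ResolutionOfSingularities.ResolutionOfSingularities.Theorems.ValuativeLupiRestriction
import Literature.AlgebraicGeometry.Resolution.JacobianRegularLocus
import Mathlib.RingTheory.Unramified.Field
import Mathlib.RingTheory.Valuation.Integral
import HarnessLib

/-!
# `LogCanQuotLU` — negative lemmas, part 0: bookkeeping (models over trivial valuations, perfect
# finitely generated fields, relative transport of a model along a field embedding)

Support file for the negative lemmas of crux `stmt-ResolutionOfSingularities-17082`
(`Summit.ResolutionOfSingularities.ResolutionOfSingularities.Theses.FoliationDescent.LogCanQuotLU`),
filed by the standing disprover (cdisprove cycle 1; work file `Cruxes/LogCanQuotLU/Disproof.lean`;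
used by `Negative/WithoutRegularTop.lean`). Pure commutative algebra over Mathlib's
`ValuationSubring` / `Subalgebra` / `Localization.AtPrime` / `IsRegularLocalRing`; no definition is
declared and nothing here mentions the route.

* `mem_of_isIntegral` — valuation rings contain the elements integral over the ground field;
* `forall_mem_of_forall_pow_eq` — a finitely generated `K/k` of characteristic `p` in which every
  element is a `p`-th power is (separable) algebraic over `k` (`Ω_{K/k} = 0`: `d(b^p) = 0`; a
  formally unramified extension essentially of finite type is separable), so every valuation ring
  `O ⊇ k` of `K` is all of `K`;
* `exists_regular_of_forall_mem` — over the trivial valuation every affine model is regular at the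
  centre (the centre is `(0)`, its local ring the field `K`);
* `exists_model_comap_of_model` — RELATIVE TRANSPORT: an affine model `A ⊆ O` of `K` realised
  inside `L ⊇ K`, regular at the centre and containing the image of `R ⊆ K`, pulls back to a model
  of `K` inside `O ∩ K` containing `R`, regular at the centre of `O ∩ K` (the `R`-keeping form of
  `Pialt.RadiciallyRegular.isLocallyUniformizable_comap_of_model`).

## Sources
* O. Zariski, P. Samuel, *Commutative Algebra* II (1960), Ch. VI (valuation rings are integrally
  closed; places of algebraic function fields). [ZariskiSamuel1960]
-/

noncomputable section

set_option linter.dupNamespace false -- mandated namespace of this single-conjunct summit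

open IsLocalRing Polynomial
open Literature.AlgebraicGeometry.Resolution
open Summit.ResolutionOfSingularities.ResolutionOfSingularities.Theorems

namespace Summit.ResolutionOfSingularities.ResolutionOfSingularities.Theorems.LogCanQuotLU.Negative

/-! ## Bookkeeping helpers -/

section Helpers

variable {k K : Type} [Field k] [Field K] [Algebra k K]

/-- A valuation ring containing the ground field contains every element integral over it.
[folklore] -/
theorem mem_of_isIntegral (O : ValuationSubring K) (hO : ∀ c : k, algebraMap k K c ∈ O) {x : K}
    (hx : IsIntegral k x) : x ∈ O := by
  obtain ⟨f, hfm, hfx⟩ := hx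
  let ι : k →+* O := (algebraMap k K).codRestrict O.toSubring hO
  have hint : IsIntegral O x := by
    refine ⟨f.map ι, hfm.map ι, ?_⟩
    rw [Polynomial.eval₂_map]
    exact hfx
  have hVint : O.valuation.Integers O :=
    { hom_inj := Subtype.coe_injective
      map_le_one := fun r => O.valuation_le_one r
      exists_of_le_one := fun r hr => ⟨⟨r, (O.valuation_le_one_iff r).mp hr⟩, rfl⟩ }
  exact (O.valuation_le_one_iff x).mp (hVint.isIntegral_iff_v_le_one.mp hint)

/-- A subalgebra containing an affine model of `K` is again a model. [folklore] -/
theorem isFractionRing_of_le {A A' : Subalgebra k K} (hle : A ≤ A') (hA : IsFractionRing A K) :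
    IsFractionRing A' K := by
  refine IsFractionRing.of_field A' K fun z => ?_
  obtain ⟨a, b, -, rfl⟩ := IsFractionRing.div_surjective (A := A) z
  exact ⟨⟨a, hle a.2⟩, ⟨b, hle b.2⟩, rfl⟩

/-- The localisation of a domain at `(0)` is a field, hence a regular local ring. [folklore] -/
theorem isRegularLocalRing_localization_bot {B : Type} [CommRing B] [IsDomain B] :
    IsRegularLocalRing (Localization.AtPrime (⊥ : Ideal B)) := by
  haveI : IsLocalization (nonZeroDivisors B) (Localization.AtPrime (⊥ : Ideal B)) := by
    rw [← Ideal.primeCompl_bot]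
    infer_instance
  letI : Field (Localization.AtPrime (⊥ : Ideal B)) := IsFractionRing.toField B
  infer_instance

/-- **A finitely generated extension of `k` in which every element is a `p`-th power is
algebraic over `k`, so every valuation ring over `k` is the whole field.** (`Ω_{K/k}` is spanned
by the `dx`, and `d(b^p) = p b^{p-1} db = 0`; a formally unramified extension essentially of finite
type is separable algebraic; valuation rings are integrally closed.) [folklore] -/
theorem forall_mem_of_forall_pow_eq {p : ℕ} [CharP k p]
    (hKfg : (⊤ : IntermediateField k K).FG) (hperf : ∀ a : K, ∃ b : K, b ^ p = a)
    (O : ValuationSubring K) (hO : ∀ c : k, algebraMap k K c ∈ O) : ∀ x : K, x ∈ O := by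
  haveI : CharP K p := charP_of_injective_algebraMap (algebraMap k K).injective p
  haveI : Algebra.EssFiniteType k K := IntermediateField.fg_top_iff.mp hKfg
  have hD0 : ∀ x : K, KaehlerDifferential.D k K x = 0 := fun x => by
    obtain ⟨b, rfl⟩ := hperf x
    rw [Derivation.leibniz_pow, ← Nat.cast_smul_eq_nsmul K, CharP.cast_eq_zero, zero_smul]
  haveI : Subsingleton (Ω[K⁄k]) := by
    refine ⟨fun a b => ?_⟩
    have h : (⊤ : Submodule K (Ω[K⁄k])) = ⊥ := by
      rw [← KaehlerDifferential.span_range_derivation, Submodule.span_eq_bot]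
      rintro _ ⟨x, rfl⟩
      exact hD0 x
    have ha : a ∈ (⊤ : Submodule K (Ω[K⁄k])) := Submodule.mem_top
    have hb : b ∈ (⊤ : Submodule K (Ω[K⁄k])) := Submodule.mem_top
    rw [h, Submodule.mem_bot] at ha hb
    rw [ha, hb]
  haveI : Algebra.FormallyUnramified k K := ⟨‹_›⟩
  haveI : Algebra.IsSeparable k K := Algebra.FormallyUnramified.isSeparable k K
  intro x
  exact mem_of_isIntegral O hO (Algebra.IsSeparable.isIntegral k x)

/-- Over the TRIVIAL valuation (`O = K`) every affine model is regular at the centre (the centre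
is the generic point; its local ring is the field `K`). [folklore] -/
theorem exists_regular_of_forall_mem (O : ValuationSubring K) (hOtop : ∀ x : K, x ∈ O)
    (R₁ : Subalgebra k K) (hfg : R₁.FG) (hfr : IsFractionRing R₁ K) :
    ∃ (A : Subalgebra k K) (h : A.toSubring ≤ O.toSubring), R₁ ≤ A ∧ A.FG ∧ IsFractionRing A K ∧
      IsRegularLocalRing
        (Localization.AtPrime (Ideal.comap (Subring.inclusion h) (maximalIdeal O))) := by
  have h : R₁.toSubring ≤ O.toSubring := fun x _ => hOtop x
  refine ⟨R₁, h, le_rfl, hfg, hfr, ?_⟩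
  have hP : Ideal.comap (Subring.inclusion h) (maximalIdeal O) = ⊥ := by
    refine le_bot_iff.mp fun a ha => ?_
    rw [Ideal.mem_comap, IsLocalRing.mem_maximalIdeal, mem_nonunits_iff] at ha
    rw [Ideal.mem_bot]
    by_contra hne
    have hane : (a : K) ≠ 0 := fun h0 => hne (Subtype.ext h0)
    exact ha (IsUnit.of_mul_eq_one ⟨(a : K)⁻¹, hOtop _⟩ (Subtype.ext (mul_inv_cancel₀ hane)))
  haveI : (⊥ : Ideal R₁.toSubring).IsPrime := Ideal.isPrime_bot
  exact isRegularLocalRing_localization_atPrime_congr hP.symm isRegularLocalRing_localization_bot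

/-- **Relative transport** of a model realised inside a bigger field, keeping `R`: an affine
model `A ⊆ O` of `K` realised inside `L ⊇ K`, regular at the centre of `O` and containing the
image of `R ⊆ K`, pulls back to a model of `K` inside `O ∩ K` containing `R`, regular at the
centre of `O ∩ K` (as in `Cruxes/DualSandwich/StubRelStepProof.lean`). [folklore] -/
theorem exists_model_comap_of_model {L : Type} [Field L] [Algebra k L] (f : K →ₐ[k] L)
    (O : ValuationSubring L) (A : Subalgebra k L) (hA : A.toSubring ≤ O.toSubring)
    (hAK : ∀ x ∈ A, x ∈ Set.range f) (hfg : A.FG)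
    (hfrac : ∀ z : K, ∃ a b : L, a ∈ A ∧ b ∈ A ∧ b ≠ 0 ∧ f z = a / b)
    (hreg : IsRegularLocalRing (Localization.AtPrime
      (Ideal.comap (Subring.inclusion hA) (maximalIdeal O))))
    (R : Subalgebra k K) (hR : R.map f ≤ A) :
    ∃ (A₀ : Subalgebra k K) (h₀ : A₀.toSubring ≤ (O.comap (f : K →+* L)).toSubring),
      R ≤ A₀ ∧ A₀.FG ∧ IsFractionRing A₀ K ∧
      IsRegularLocalRing (Localization.AtPrime
        (Ideal.comap (Subring.inclusion h₀) (maximalIdeal (O.comap (f : K →+* L))))) := by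
  classical
  have hfinj : Function.Injective f := (f : K →+* L).injective
  set A₀ : Subalgebra k K := A.comap f with hA₀
  have hmap : A₀.map f = A := by
    rw [hA₀, Subalgebra.map_comap_eq]
    exact inf_eq_left.mpr fun x hx => hAK x hx
  have h₀ : A₀.toSubring ≤ (O.comap (f : K →+* L)).toSubring := fun x hx => hA hx
  have hA₀fg : A₀.FG := Subalgebra.fg_of_fg_map _ f hfinj (by rw [hmap]; exact hfg)
  have hA₀fr : IsFractionRing A₀ K := by
    refine IsFractionRing.of_field A₀ K fun z => ?_
    obtain ⟨a, b, ha, hb, _, hz⟩ := hfrac z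
    obtain ⟨a₀, rfl⟩ := hAK a ha
    obtain ⟨b₀, rfl⟩ := hAK b hb
    refine ⟨⟨a₀, show f a₀ ∈ A from ha⟩, ⟨b₀, show f b₀ ∈ A from hb⟩, hfinj ?_⟩
    rw [hz, map_div₀]
    rfl
  have hRA₀ : R ≤ A₀ := Subalgebra.map_le.mp hR
  refine ⟨A₀, h₀, hRA₀, hA₀fg, hA₀fr, ?_⟩
  have hmapS : A₀.toSubring.map (f : K →+* L) = A.toSubring := by
    ext z
    simp only [Subring.mem_map, Subalgebra.mem_toSubring]
    constructor
    · rintro ⟨x, hx, rfl⟩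
      exact hx
    · intro hz
      obtain ⟨x, rfl⟩ := hAK z hz
      exact ⟨x, hz, rfl⟩
  let e : A₀.toSubring ≃+* A.toSubring :=
    (A₀.toSubring.equivMapOfInjective (f : K →+* L) hfinj).trans (RingEquiv.subringCongr hmapS)
  have he : ∀ a : A₀.toSubring, ((e a : A.toSubring) : L) = f a := fun a => rfl
  set P : Ideal A.toSubring := Ideal.comap (Subring.inclusion hA) (maximalIdeal O) with hP
  haveI hPp : P.IsPrime := Ideal.comap_isPrime _ _
  have hPe : P.comap (e : A₀.toSubring →+* A.toSubring) =
      Ideal.comap (Subring.inclusion h₀) (maximalIdeal (O.comap (f : K →+* L))) := by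
    ext a
    have h2 : Subring.inclusion hA (e a) = ⟨f a, hA (e a).2⟩ := Subtype.ext (he a)
    simp only [Ideal.mem_comap, hP, RingHom.coe_coe]
    rw [h2]
    exact (Lupi.mk_mem_maximalIdeal_comap_iff O (f : K →+* L) (h₀ a.2)).symm
  haveI : (P.comap (e : A₀.toSubring →+* A.toSubring)).IsPrime := Ideal.comap_isPrime _ _
  exact isRegularLocalRing_localization_atPrime_congr hPe
    ((Lupi.isRegularLocalRing_localization_iff_of_ringEquiv e P).mp hreg)

end Helpers

end Summit.ResolutionOfSingularities.ResolutionOfSingularities.Theorems.LogCanQuotLU.Negative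

end
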